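import Summits.Ventures.CertifiedManyBodySolver.Certificates.HubbardSquare_transportClosure_Kit
import Literature.MathematicalPhysics.QuantumLattice.HubbardNNNHoppingEnergyDensityMonotone
import HarnessLib

/-!
# Ventures/CertifiedManyBodySolver — Certificates/HubbardSquare_transportClosure_KitZ.lean
# (hubbard-fast-reuse-3 g6, cell hubbard-fast, D-0154 (A) CERTIFICATE REUSE: the TRANSPORT-CLOSURE kit, part Z = the U = 0 (ZERO-COUPLING, FREE-GAS) ANCHOR and the
# ELECTRON-DOPED `U`-CARRY; companions of `…_Kit` (slices), `…_KitLaws` (laws), `…_KitU` (HF U-down), `…_KitT/KitS` (t′-chords, sheets), `…_KitF/KitF2` (reuse-5's fans))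

Three small GLUE adapters and two LAWS that the cell's `_mlword_Icc` words on the low-`U` / electron-doped boxes kept re-deriving inline
(C-124 `fzM56_*`, `HubbardSquare_fz_nd2cuo4_M56`):
* `tc_sliceU0_floor_of_freeRow` — a kernel tangent Fermi-sea row `S + μ·n ≤ e(t, s₀, U, n)` (every `U ≥ 0`, every `0 ≤ n < 2`; files
  `HubbardFermiSeaTangentRows*`) read as the bilinear `U`-slice floor AT `U₀ = 0` on the degenerate strip `[s₀, s₀] × [n₁, n₂]` — exactly the `hA`
  input of `KitLaws.tc_mlFloor_Uchord` with `U₀ := 0`: the «FREE-ANCHOR U-CHORD» (concavity of `U ↦ e₀` on `[0, U₁]` read as the chord through the EXACT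
  free gas instead of the Hartree–Fock down-price `(U₁ − U)(n/2)²` of `KitU.tc_mlFloor_Udown`; the chord slope `(A(U₁) − e_free)/U₁` is always ≤ `(n/2)²`).
* `tc_sliceU_floor_of_sliceT_point` — a `(U, n)`-bilinear floor at the hopping POINT `s₀` read on `U ∈ [U', U']` (the output shape of
  `KitS.tc_sheetT_floor[_phImage]` with `U₁ = U₂ = U'`) re-read as the `U`-slice shape at `U'` on `[s₀, s₀] × [n₁, n₂]` (the `hB` input of `tc_mlFloor_Uchord`).
* `tc_sliceT_floor_of_mlFloor_point` — an 8-coefficient floor on a cell DEGENERATE in `t'` (`[Ua, Ub] × [s₀, s₀] × [n₁, n₂]`, e.g. the output of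
  `tc_mlFloor_Uchord` on such a cell) read back as the `(U, n)`-bilinear floor at `s₀` (the `hA`/`hB` input of `KitT.tc_mlFloor_tchord`).
* `tc_mlFloor_Ucarry_above_of_one_le` / `tc_mlCap_Ucarry_below_of_one_le` — on the ELECTRON-DOPED side (`n ≥ 1`) a floor carries UP in `U` and a cap
  carries DOWN in `U` with slope `(n − 1)`, not `0`: `e(t,s,U,n) − e(t,s,U₀,n) ≥ (U − U₀)(n − 1)` for `0 ≤ U₀ ≤ U` (every site holds at least `n − 1`
  doubly occupied pairs; here derived as particle–hole symmetry `e(t,s,U,n) = e(t,−s,U,2−n) + U(n−1)` (`energyDensityTT'_particleHole`) + monotonicity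
  in `U` at density `2 − n` (`energyDensityTT'_mono_U`)). `KitLaws.tc_mlFloor_Umono_above` / `tc_mlCap_Umono_below` are the `n ≤ 1` (slope-0) forms.
Every law returns a literal 8-coefficient form checked against the exact (tri)linear transported bound at the eight vertices (vertex rule,
`trilinear_nonneg_on_Icc₃`). HONEST FRAMING: bookkeeping adapters around tree lemmas; they certify nothing by themselves; every consumer word inherits
exactly the hypotheses of the rows/sheets it cites; no number of record; not a phase word; no summit statement is proved here; not a superconductivity verdict.
-/

namespace Summit.Ventures.CertifiedManyBodySolver.Certificates

open Literature.MathematicalPhysics.QuantumLattice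
open Literature.MathematicalPhysics.QuantumLattice.ThermodynamicLimit
open Set

/-! ### §1 Glue: the free row at `U = 0`, point slices -/

/-- **Free row ⇒ `U`-slice floor at `U₀ = 0`.** A tangent Fermi-sea row `S + μ·n ≤ e(t, s₀, U, n)` (all `U ≥ 0`, `0 ≤ n < 2`) gives, on the
degenerate strip `s ∈ [s₀, s₀]`, `n ∈ [n₁, n₂] ⊂ [0, 2)`, the bilinear floor `S + 0·s + μ·n + 0·s·n ≤ e(t, s, 0, n)` — the `hA` input of
`tc_mlFloor_Uchord` with `U₀ := 0` (the exact `U = 0` anchor of the free-anchor `U`-chord). [cite: LiebLoss1993, §8, Theorem 8.2] -/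
theorem tc_sliceU0_floor_of_freeRow (t : ℝ) {s₀ S μ n₁ n₂ : ℝ}
    (hrow : ∀ U : ℝ, 0 ≤ U → ∀ n : ℝ, 0 ≤ n → n < 2 → S + μ * n ≤ energyDensityTT' t s₀ U n)
    (hn₁ : 0 ≤ n₁) (hn₂ : n₂ < 2) :
    ∀ s n : ℝ, s₀ ≤ s → s ≤ s₀ → n₁ ≤ n → n ≤ n₂ →
      S + 0 * s + μ * n + 0 * s * n ≤ energyDensityTT' t s 0 n := by
  intro s n h1 h2 h3 h4
  have hs : s = s₀ := le_antisymm h2 h1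
  rw [hs]
  have h := hrow 0 le_rfl n (hn₁.trans h3) (lt_of_le_of_lt h4 hn₂)
  linarith

/-- **`(U, n)`-floor at a hopping point, read on `U ∈ [U', U']` ⇒ `U`-slice floor at `U'`.** If `α₀ + α₁U + α₂n + α₃Un ≤ e(t, s₀, U, n)` for
`U' ≤ U ≤ U'`, `n₁ ≤ n ≤ n₂` (the conclusion shape of `tc_sheetT_floor` / `tc_sheetT_floor_phImage` with `U₁ = U₂ = U'`), then on the degenerate strip
`[s₀, s₀] × [n₁, n₂]`: `(α₀ + α₁U') + 0·s + (α₂ + α₃U')·n + 0·s·n ≤ e(t, s, U', n)` — the `hB` input of `tc_mlFloor_Uchord`. [cite: Ruelle1969, §3.3] -/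
theorem tc_sliceU_floor_of_sliceT_point (t : ℝ) {s₀ U' n₁ n₂ α₀ α₁ α₂ α₃ : ℝ}
    (hT : ∀ U n : ℝ, U' ≤ U → U ≤ U' → n₁ ≤ n → n ≤ n₂ →
      α₀ + α₁ * U + α₂ * n + α₃ * U * n ≤ energyDensityTT' t s₀ U n) :
    ∀ s n : ℝ, s₀ ≤ s → s ≤ s₀ → n₁ ≤ n → n ≤ n₂ →
      (α₀ + α₁ * U') + 0 * s + (α₂ + α₃ * U') * n + 0 * s * n ≤ energyDensityTT' t s U' n := by
  intro s n h1 h2 h3 h4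
  have hs : s = s₀ := le_antisymm h2 h1
  rw [hs]
  have h := hT U' n le_rfl le_rfl h3 h4
  linarith

/-- **8-coefficient floor on a `t'`-degenerate cell ⇒ `(U, n)`-floor at that hopping.** If the literal form `c` is a floor on
`Set.Icc ![Ua, s₀, n₁] ![Ub, s₀, n₂]` (e.g. the output of `tc_mlFloor_Uchord` on the strip `[s₀, s₀]`), then for `Ua ≤ U ≤ Ub`, `n₁ ≤ n ≤ n₂`:
`(c₀ + c₂s₀) + (c₁ + c₄s₀)U + (c₃ + c₆s₀)n + (c₅ + c₇s₀)Un ≤ e(t, s₀, U, n)` — the `hA`/`hB` input of `KitT.tc_mlFloor_tchord`. [cite: Israel1979, Thm. I.3.4] -/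
theorem tc_sliceT_floor_of_mlFloor_point (t : ℝ) {s₀ Ua Ub n₁ n₂ c₀ c₁ c₂ c₃ c₄ c₅ c₆ c₇ : ℝ}
    (h : ∀ θ ∈ Set.Icc (![Ua, s₀, n₁] : Fin 3 → ℝ) ![Ub, s₀, n₂],
      c₀ + c₁ * θ 0 + c₂ * θ 1 + c₃ * θ 2 + c₄ * θ 0 * θ 1 + c₅ * θ 0 * θ 2 + c₆ * θ 1 * θ 2 +
        c₇ * θ 0 * θ 1 * θ 2 ≤ energyDensityTT' t (θ 1) (θ 0) (θ 2)) :
    ∀ U n : ℝ, Ua ≤ U → U ≤ Ub → n₁ ≤ n → n ≤ n₂ →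
      (c₀ + c₂ * s₀) + (c₁ + c₄ * s₀) * U + (c₃ + c₆ * s₀) * n + (c₅ + c₇ * s₀) * U * n ≤
        energyDensityTT' t s₀ U n := by
  intro U n h1 h2 h3 h4
  have hθ := h ![U, s₀, n] (mem_Icc_vec3_iff.2 ⟨⟨h1, h2⟩, ⟨le_rfl, le_rfl⟩, ⟨h3, h4⟩⟩)
  simp only [Matrix.cons_val_zero, Matrix.cons_val_one, Matrix.cons_val] at hθ
  linear_combination hθ

/-! ### §2 Laws: the electron-doped `U`-carry (slope `n − 1`) -/

/-- **FLOOR CARRIED UP IN `U` ON THE ELECTRON-DOPED SIDE** (slope `n − 1`): a bilinear floor `α(s, n) ≤ e(t, s, U₀, n)` on `[s₁, s₂] × [n₁, n₂]`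
with `1 ≤ n₁`, `n₂ < 2`, `0 ≤ U₀`, gives for `U₀ ≤ Ua ≤ θ0 ≤ Ub`: `e(θ) ≥ α(θ1, θ2) + (θ0 − U₀)(θ2 − 1)` (particle–hole symmetry
`e(t,s,U,n) = e(t,−s,U,2−n) + U(n−1)` and monotonicity in `U` at density `2 − n`; equivalently: every site carries at least `n − 1` doubly occupied
pairs); a literal trilinear form below the right-hand side at the eight vertices is a floor on the cell. [cite: LiebWuPhysicaA2003, §1 eq. (3)] [cite: Ruelle1969, §3.3] -/
theorem tc_mlFloor_Ucarry_above_of_one_le (t : ℝ) {U₀ Ua Ub s₁ s₂ n₁ n₂ α₀ α₁ α₂ α₃ c₀ c₁ c₂ c₃ c₄ c₅ c₆ c₇ : ℝ}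
    (hU₀ : 0 ≤ U₀) (hUa : U₀ ≤ Ua) (hn₁ : 1 ≤ n₁) (hn₂ : n₂ < 2)
    (hA : ∀ s n : ℝ, s₁ ≤ s → s ≤ s₂ → n₁ ≤ n → n ≤ n₂ →
      α₀ + α₁ * s + α₂ * n + α₃ * s * n ≤ energyDensityTT' t s U₀ n)
    (v₁₁₁ : c₀ + c₁ * Ua + c₂ * s₁ + c₃ * n₁ + c₄ * Ua * s₁ + c₅ * Ua * n₁ + c₆ * s₁ * n₁ + c₇ * Ua * s₁ * n₁ ≤
      (α₀ + α₁ * s₁ + α₂ * n₁ + α₃ * s₁ * n₁) + (Ua - U₀) * (n₁ - 1))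
    (v₁₁₂ : c₀ + c₁ * Ua + c₂ * s₁ + c₃ * n₂ + c₄ * Ua * s₁ + c₅ * Ua * n₂ + c₆ * s₁ * n₂ + c₇ * Ua * s₁ * n₂ ≤
      (α₀ + α₁ * s₁ + α₂ * n₂ + α₃ * s₁ * n₂) + (Ua - U₀) * (n₂ - 1))
    (v₁₂₁ : c₀ + c₁ * Ua + c₂ * s₂ + c₃ * n₁ + c₄ * Ua * s₂ + c₅ * Ua * n₁ + c₆ * s₂ * n₁ + c₇ * Ua * s₂ * n₁ ≤
      (α₀ + α₁ * s₂ + α₂ * n₁ + α₃ * s₂ * n₁) + (Ua - U₀) * (n₁ - 1))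
    (v₁₂₂ : c₀ + c₁ * Ua + c₂ * s₂ + c₃ * n₂ + c₄ * Ua * s₂ + c₅ * Ua * n₂ + c₆ * s₂ * n₂ + c₇ * Ua * s₂ * n₂ ≤
      (α₀ + α₁ * s₂ + α₂ * n₂ + α₃ * s₂ * n₂) + (Ua - U₀) * (n₂ - 1))
    (v₂₁₁ : c₀ + c₁ * Ub + c₂ * s₁ + c₃ * n₁ + c₄ * Ub * s₁ + c₅ * Ub * n₁ + c₆ * s₁ * n₁ + c₇ * Ub * s₁ * n₁ ≤
      (α₀ + α₁ * s₁ + α₂ * n₁ + α₃ * s₁ * n₁) + (Ub - U₀) * (n₁ - 1))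
    (v₂₁₂ : c₀ + c₁ * Ub + c₂ * s₁ + c₃ * n₂ + c₄ * Ub * s₁ + c₅ * Ub * n₂ + c₆ * s₁ * n₂ + c₇ * Ub * s₁ * n₂ ≤
      (α₀ + α₁ * s₁ + α₂ * n₂ + α₃ * s₁ * n₂) + (Ub - U₀) * (n₂ - 1))
    (v₂₂₁ : c₀ + c₁ * Ub + c₂ * s₂ + c₃ * n₁ + c₄ * Ub * s₂ + c₅ * Ub * n₁ + c₆ * s₂ * n₁ + c₇ * Ub * s₂ * n₁ ≤
      (α₀ + α₁ * s₂ + α₂ * n₁ + α₃ * s₂ * n₁) + (Ub - U₀) * (n₁ - 1))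
    (v₂₂₂ : c₀ + c₁ * Ub + c₂ * s₂ + c₃ * n₂ + c₄ * Ub * s₂ + c₅ * Ub * n₂ + c₆ * s₂ * n₂ + c₇ * Ub * s₂ * n₂ ≤
      (α₀ + α₁ * s₂ + α₂ * n₂ + α₃ * s₂ * n₂) + (Ub - U₀) * (n₂ - 1)) :
    ∀ θ ∈ Set.Icc (![Ua, s₁, n₁] : Fin 3 → ℝ) ![Ub, s₂, n₂],
      c₀ + c₁ * θ 0 + c₂ * θ 1 + c₃ * θ 2 + c₄ * θ 0 * θ 1 + c₅ * θ 0 * θ 2 + c₆ * θ 1 * θ 2 +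
        c₇ * θ 0 * θ 1 * θ 2 ≤ energyDensityTT' t (θ 1) (θ 0) (θ 2) := by
  intro θ hθ
  obtain ⟨⟨k1, k2⟩, ⟨k3, k4⟩, ⟨k5, k6⟩⟩ := mem_Icc_vec3_iff.1 hθ
  have hU : 0 ≤ θ 0 := hU₀.trans (hUa.trans k1)
  have hn0 : 0 < θ 2 := lt_of_lt_of_le one_pos (hn₁.trans k5)
  have hn2 : θ 2 < 2 := lt_of_le_of_lt k6 hn₂
  have hA' := hA (θ 1) (θ 2) k3 k4 k5 k6
  have hph := energyDensityTT'_particleHole t (θ 1) hU hn0 hn2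
  have hph0 := energyDensityTT'_particleHole t (θ 1) hU₀ hn0 hn2
  have hm := energyDensityTT'_mono_U t (-(θ 1)) (n := 2 - θ 2) (by linarith) (by linarith) hU₀ (hUa.trans k1)
  have hv := trilinear_nonneg_on_Icc₃ (a₀ := Ua) (a₁ := s₁) (a₂ := n₁) (b₀ := Ub) (b₁ := s₂) (b₂ := n₂)
    (c₀ := α₀ + U₀ - c₀) (c₁ := -1 - c₁) (c₂ := α₁ - c₂) (c₃ := α₂ - U₀ - c₃) (c₄ := -c₄) (c₅ := 1 - c₅) (c₆ := α₃ - c₆) (c₇ := -c₇)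
    (by linear_combination v₁₁₁) (by linear_combination v₁₁₂) (by linear_combination v₁₂₁) (by linear_combination v₁₂₂) (by linear_combination v₂₁₁) (by linear_combination v₂₁₂) (by linear_combination v₂₂₁) (by linear_combination v₂₂₂) θ hθ
  linear_combination hA' + hm + hv - hph + hph0

/-- **CAP CARRIED DOWN IN `U` ON THE ELECTRON-DOPED SIDE** (slope `n − 1`): a bilinear cap `e(t, s, U₁, n) ≤ β(s, n)` on `[s₁, s₂] × [n₁, n₂]` with
`1 ≤ n₁`, `n₂ < 2`, gives for `0 ≤ Ua ≤ θ0 ≤ Ub ≤ U₁`: `e(θ) ≤ β(θ1, θ2) − (U₁ − θ0)(θ2 − 1)`; a literal trilinear form above the right-hand side at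
the eight vertices caps the cell. [cite: LiebWuPhysicaA2003, §1 eq. (3)] [cite: Ruelle1969, §3.3] -/
theorem tc_mlCap_Ucarry_below_of_one_le (t : ℝ) {U₁ Ua Ub s₁ s₂ n₁ n₂ β₀ β₁ β₂ β₃ c₀ c₁ c₂ c₃ c₄ c₅ c₆ c₇ : ℝ}
    (hUa : 0 ≤ Ua) (hUb : Ub ≤ U₁) (hn₁ : 1 ≤ n₁) (hn₂ : n₂ < 2)
    (hB : ∀ s n : ℝ, s₁ ≤ s → s ≤ s₂ → n₁ ≤ n → n ≤ n₂ →
      energyDensityTT' t s U₁ n ≤ β₀ + β₁ * s + β₂ * n + β₃ * s * n)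
    (v₁₁₁ : (β₀ + β₁ * s₁ + β₂ * n₁ + β₃ * s₁ * n₁) - (U₁ - Ua) * (n₁ - 1) ≤
      c₀ + c₁ * Ua + c₂ * s₁ + c₃ * n₁ + c₄ * Ua * s₁ + c₅ * Ua * n₁ + c₆ * s₁ * n₁ + c₇ * Ua * s₁ * n₁)
    (v₁₁₂ : (β₀ + β₁ * s₁ + β₂ * n₂ + β₃ * s₁ * n₂) - (U₁ - Ua) * (n₂ - 1) ≤
      c₀ + c₁ * Ua + c₂ * s₁ + c₃ * n₂ + c₄ * Ua * s₁ + c₅ * Ua * n₂ + c₆ * s₁ * n₂ + c₇ * Ua * s₁ * n₂)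
    (v₁₂₁ : (β₀ + β₁ * s₂ + β₂ * n₁ + β₃ * s₂ * n₁) - (U₁ - Ua) * (n₁ - 1) ≤
      c₀ + c₁ * Ua + c₂ * s₂ + c₃ * n₁ + c₄ * Ua * s₂ + c₅ * Ua * n₁ + c₆ * s₂ * n₁ + c₇ * Ua * s₂ * n₁)
    (v₁₂₂ : (β₀ + β₁ * s₂ + β₂ * n₂ + β₃ * s₂ * n₂) - (U₁ - Ua) * (n₂ - 1) ≤
      c₀ + c₁ * Ua + c₂ * s₂ + c₃ * n₂ + c₄ * Ua * s₂ + c₅ * Ua * n₂ + c₆ * s₂ * n₂ + c₇ * Ua * s₂ * n₂)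
    (v₂₁₁ : (β₀ + β₁ * s₁ + β₂ * n₁ + β₃ * s₁ * n₁) - (U₁ - Ub) * (n₁ - 1) ≤
      c₀ + c₁ * Ub + c₂ * s₁ + c₃ * n₁ + c₄ * Ub * s₁ + c₅ * Ub * n₁ + c₆ * s₁ * n₁ + c₇ * Ub * s₁ * n₁)
    (v₂₁₂ : (β₀ + β₁ * s₁ + β₂ * n₂ + β₃ * s₁ * n₂) - (U₁ - Ub) * (n₂ - 1) ≤
      c₀ + c₁ * Ub + c₂ * s₁ + c₃ * n₂ + c₄ * Ub * s₁ + c₅ * Ub * n₂ + c₆ * s₁ * n₂ + c₇ * Ub * s₁ * n₂)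
    (v₂₂₁ : (β₀ + β₁ * s₂ + β₂ * n₁ + β₃ * s₂ * n₁) - (U₁ - Ub) * (n₁ - 1) ≤
      c₀ + c₁ * Ub + c₂ * s₂ + c₃ * n₁ + c₄ * Ub * s₂ + c₅ * Ub * n₁ + c₆ * s₂ * n₁ + c₇ * Ub * s₂ * n₁)
    (v₂₂₂ : (β₀ + β₁ * s₂ + β₂ * n₂ + β₃ * s₂ * n₂) - (U₁ - Ub) * (n₂ - 1) ≤
      c₀ + c₁ * Ub + c₂ * s₂ + c₃ * n₂ + c₄ * Ub * s₂ + c₅ * Ub * n₂ + c₆ * s₂ * n₂ + c₇ * Ub * s₂ * n₂) :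
    ∀ θ ∈ Set.Icc (![Ua, s₁, n₁] : Fin 3 → ℝ) ![Ub, s₂, n₂],
      energyDensityTT' t (θ 1) (θ 0) (θ 2) ≤ c₀ + c₁ * θ 0 + c₂ * θ 1 + c₃ * θ 2 + c₄ * θ 0 * θ 1 +
        c₅ * θ 0 * θ 2 + c₆ * θ 1 * θ 2 + c₇ * θ 0 * θ 1 * θ 2 := by
  intro θ hθ
  obtain ⟨⟨k1, k2⟩, ⟨k3, k4⟩, ⟨k5, k6⟩⟩ := mem_Icc_vec3_iff.1 hθ
  have hU : 0 ≤ θ 0 := hUa.trans k1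
  have hU₁ : 0 ≤ U₁ := hU.trans (k2.trans hUb)
  have hn0 : 0 < θ 2 := lt_of_lt_of_le one_pos (hn₁.trans k5)
  have hn2 : θ 2 < 2 := lt_of_le_of_lt k6 hn₂
  have hB' := hB (θ 1) (θ 2) k3 k4 k5 k6
  have hph := energyDensityTT'_particleHole t (θ 1) hU hn0 hn2
  have hph1 := energyDensityTT'_particleHole t (θ 1) hU₁ hn0 hn2
  have hm := energyDensityTT'_mono_U t (-(θ 1)) (n := 2 - θ 2) (by linarith) (by linarith) hU (k2.trans hUb)
  have hv := trilinear_nonneg_on_Icc₃ (a₀ := Ua) (a₁ := s₁) (a₂ := n₁) (b₀ := Ub) (b₁ := s₂) (b₂ := n₂)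
    (c₀ := c₀ - (β₀ + U₁)) (c₁ := c₁ + 1) (c₂ := c₂ - β₁) (c₃ := c₃ - (β₂ - U₁)) (c₄ := c₄) (c₅ := c₅ - 1) (c₆ := c₆ - β₃) (c₇ := c₇)
    (by linear_combination v₁₁₁) (by linear_combination v₁₁₂) (by linear_combination v₁₂₁) (by linear_combination v₁₂₂) (by linear_combination v₂₁₁) (by linear_combination v₂₁₂) (by linear_combination v₂₂₁) (by linear_combination v₂₂₂) θ hθ
  linear_combination hB' + hm + hv + hph - hph1

end Summit.Ventures.CertifiedManyBodySolver.Certificates
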